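import Literature.MathematicalPhysics.QuantumFieldTheory.Balaban1983to89.T4TermwiseBudget
import Literature.MathematicalPhysics.QuantumFieldTheory.Balaban1983to89.T4MatchingClosure

/-!
# T⁴ continuum, node U5 (NE7), TERM-WISE member — END TO END and the QUANTITATIVE TAIL of the route

Lineage t4-ne7-p1 (term-wise matching modulo constants), generation 4.  HONEST FRAMING (page 1): pure YM₄ on a FIXED
FINITE torus T⁴, rung (B)+1 of the cell's ladder = the `ε → 0` limit of expectations of gauge-invariant observables;
NOT infinite volume, NOT a mass gap, NOT the Clay problem.  Spine estimate NE7 (node U5: for every `K` a `t`-independent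
constant `c_K` with `|log Z^B_{K+1}(t) − log Z^A_K(t) − c_K| ≤ δ_K·|T₁|`, `Σ_K δ_K < ∞`) is NOT PRINTED for Bałaban's
d = 4 procedure; its d = 2, 3 template is [King1986] (3.10)–(3.13) pp. 656–657 (TEMPLATE ONLY).  Every estimate below is a
HYPOTHESIS BINDER named in the statement; nothing of Bałaban's expansions is asserted; no conditional (BetaPertH, (B),
(B^μ)) is hidden — they sit by name inside the producers of the binders exactly where those modules declare them (node U2's
asymptotic-freedom input behind `hinj`: `T4CouplingMatching.EventualLowerH` / `T4TowerRateDischarge.uRateUpTo_of_spine`).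
All declarations are [folklore] bookkeeping (composition of tree theorems, finite sums, geometric series).  NO definitions.

## What this module adds (additive leaf; imports `T4TermwiseBudget` (gen 3) and `T4MatchingClosure` by name)

§1 PER FAMILY.  `hybridNE7_of_nodes`: the binders of `T4TermwiseBudget.goodClause_summable_of_nodes` VERBATIM (the
   sibling nodes' typed outputs composed along the tower by gens 1–3: NE9 + fading memory, Lipschitz-in-the-background with
   polynomial growth, NE5, NE3 as `LocalRate` + `GaugeDominated`, node U2's `InjectedRate` on the printed box; the term
   format (F), one-run sizes (S), multiplicity (M), other kinds (O)) PLUS NE7's other half BY NAME — the weight budget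
   `T4WeightBudget.RelWeightBound l₀ T A B Bad Wb` (binder (W), the sibling seats' output; NOT this route's, NOT PRINTED) —
   and non-negativity of all terms (L1-pos) ⇒ for the tower's `K`-uniform `Cr ≥ 0` and GRANTED hazard H-U5b-1 with it
   (binder (D)) the datum `T4MatchingAssembly.HybridNE7` with ZERO shells (`hybridNE7_noShell`).  `ne7_of_nodes`: with the
   E1/E2 dictionary `Z K t = Σ_τ A`, `Z (K+1) t = Σ_τ B` and positivity of the total, NE7 ITSELF in node U5's output shape
   `T4CauchySum.MatchingModConstants vol l₀ (hybridDelta vol δ Wb) Z`, `Summable (hybridDelta …)`, every generating function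
   Cauchy on `|t| ≤ l₀`, uniform convergence there (`T4GoodClassBudget.cauchy_of_goodClause`).
§2 PER STRING / ALL STRINGS.  `stringHybridNE7_of_nodes`: with the dictionary to `T4GenFunBounds.schemeZ Sc os (K₀+K)`,
   `T4MatchingAssembly.StringHybridNE7 Sc os l₀ vol K₀`.  `hasContinuumLimit_of_nodes` — THE CAPSTONE: tower data
   string-independent, term data indexed by the string `os`; there is ONE `Cr ≥ 0` (the tower's, the same for every
   string — obtained once from `T4TowerRateDischarge.uRateUpTo_of_nodes`, then `T4TermwiseBudget.termBudget_of_towerRate` /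
   `goodClause_summable_of_ledgerBudget` per string) such that H-U5b-1 on every string with that `Cr` gives the node-U0
   targets `HasContinuumLimit Sc ∧ HasUniqueLimitPoints Sc ∧ LimitPointsAgree Sc`
   (`T4MatchingAssembly.hasContinuumLimit_of_hybridNE7`; scheme regularity `0 ≤ β_K`, measurable `|obs| ≤ 1`, `0 < l₀`).
§3 THE QUANTITATIVE TAIL («summability from the geometric factors», sharpened to a rate).  `eBranch_le_crossover` /
   `delta_le_crossover`: the E-branch of `δ_K` is `≤ max(Cw,1)(E + Cr)(K+1)q^K`, `q = θ′^{log(1/a)/(log(Λ/θ′)+log(1/a))} < 1`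
   the crossover rate (`T4Crossover.sum_min_pow_le_crossover`, `crossoverRate_lt_one`).  From `T4CauchySum.abs_genFun_sub_lim_le`:
   `abs_genFun_sub_lim_le_of_le` (any summable majorant `d ≥ δ`: tail `2·vol·Σ_m d(K+m)`), `_of_geometric`
   (`δ ≤ Dρ^K` ⇒ `2·vol·Dρ^K/(1−ρ)`), `_of_succ_mul_geometric` (`δ ≤ D(K+1)q^K` ⇒ `2·vol·D·q^K((K+1)/(1−q) + q/(1−q)²)`),
   and `hybridDelta_le_of_le` (`hybridDelta vol δ Wb ≤ d + 2w/vol` once `Wb ≤ w ≤ 1/2`).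
   HONEST RATE VERDICT: only the E-branch is certified geometric×linear here.  The other summands of NE7's remainder — the
   other kinds `rO` (the R-kind two-run rate; along the tree's producers `T4Crossover.summable_sum_min_coupling`,
   `T4MatchingClosure.summable_polyRate_of_kappa` a comparison with `(K+1)^{−(κ₀/2−1)}`-type series), the H-U5b-1 deviations
   `s`, and the weight half `−log(1 − Wb K)/vol` (log-cut profile `V·r^{K − jlog K}` times a polynomial window count) — are
   BINDERS whose producers in the tree are only POLYNOMIALLY summable in the number of steps `K`.  Consequently the modulus
   of convergence this route delivers for `genFun` is polynomial in `K` (`K` ~ `log_L(1/ε)`), i.e. a power of `1/log(1/ε)`,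
   NOT a power of `ε`; no sharper rate is claimed anywhere in this lineage.

## Binder census of the capstone (every one a hypothesis; which are estimates)
(T) tower, string-independent, NOT PRINTED as two-run statements: `h9 hΛm hUL hG h5 hloc hgd hinj hbox hgA hgB` + signs and
the rate window `max(ω,θc) < θ′ < 1`, `θ₅, θ₃ ≤ θ′ ≤ Λ`, `0 < a < 1`.  (F) format `hfmtA hfmtB hint hsc hposO hoff`
(STRUCTURAL: the (2.25)-shape of the E-group factors, p. 259 of [Balaban1988Convergent] — a LOCATION for the vacuum-energy
subtraction, not a citation of a two-run statement).  (S) `hS hSle` one-run size centrings `≤ vol·E·a^{K−j}` (shape of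
(2.43) p. 263, one run at a time — LOCATION).  (M) `hM` multiplicity with base `Λ`.  (O) `hO hRO hrO` other kinds.
(W) `hW` `RelWeightBound` (NE7b both runs, NOT PRINTED; sibling seats).  (L1-pos) `hA hB`.  (E1/E2) `hZA hZB` dictionary.
(D) H-U5b-1, the premise of the final implication.  OUTPUT: node U0's three targets.  Non-vacuity of the term-side binder
set: `T4TermwiseBudget.toy_termBudget_nonvacuous`; of the hybrid shape: `T4MatchingAssembly.hybridNE7_trivial`.

## What is NOT delivered
The weight half (W) itself; the R-kind two-run rate inside (O); the deviation rate (D); the one-run inputs (F)(S)(M); any of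
the tower's node estimates (T).  The crux-typing checklist item (ii) is respected: every `∫` appears only inside the format
binders supplied by the caller, with integrability a named binder (`hint`).

References (LOCATIONS / TEMPLATE only; nothing here is cited as proving a binder): [King1986] C. King, The U(1) Higgs
model: I. The continuum limit, Commun. Math. Phys. 102 (1986) 649–677, (3.10)–(3.13) pp. 656–657 (template of NE7);
[Balaban1988Convergent] T. Bałaban, Convergent renormalization expansions for lattice gauge theories, Commun. Math. Phys.
119 (1988) 243–285, (2.25) p. 259, (2.43)–(2.46) p. 263 (locations of the one-run shapes); [Balaban1989LargeFieldII]
T. Bałaban, Large field renormalization II, Commun. Math. Phys. 122 (1989) 355–392, p. 355 (the β-function paper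
«has not been published yet» — why node U2's asymptotic-freedom input is a binder upstream).
-/

open Finset MeasureTheory _root_.Filter _root_.Topology

namespace Literature.MathematicalPhysics.QuantumFieldTheory.Balaban1983to89.T4TermwiseClosure

open T4OutputRate T4RecentScale T4GoodClassBudget T4CauchySum T4TowerRateComposition T4TowerRateDischarge
  T4TermwiseBudget T4HybridMatching T4MatchingAssembly T4Crossover

/-! ## §1 Per family: the term-wise node outputs + the weight half ⇒ `HybridNE7` (zero shells) ⇒ NE7 + node U6 -/

section Spine

open T4EtaRateMin (Readings LocalRate)
open T4RateLiaison (GaugeDominated)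

variable {C : Carriers} {ι X : Type} [MeasurableSpace ι] {σ : Type*} [DecidableEq σ] {l₀ vol : ℝ}
  {T : ℕ → Finset σ} {Bad : ℕ → ℝ → Finset σ} {A B : ℕ → ℝ → σ → ℝ} {μ : ℕ → ℝ → σ → Measure ι}
  {fac : ℕ → ℝ → σ → Finset C.Dom} {R : Readings ι X} {W : Set (ℕ → ℝ)} {EA : Functional C C.BgA}
  {EB : Functional C C.BgB} {κ θ₅ C₅ C₉ ω θc Cd γ C₃ θ₃ P θ' : ℝ} {q : ℕ} {Λm : ℕ → ℕ → ℝ}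
  {CU : (ℕ → ℝ) → ℕ → ℝ} {g : ℕ → ℕ → ℝ} {uA : ℕ → ι → C.BgA} {uB : ℕ → ι → C.BgB} {oneA : C.BgA} {oneB : C.BgB}
  {oA oB : ℕ → ℝ → σ → ι → ℝ} {κ₁ S : ℕ → ℝ → σ → ℕ → ℝ} {cO RO : ℕ → ℝ → σ → ℝ} {rO Wb : ℕ → ℝ} {Cw E a Λ : ℝ}

/-- **THE TERM-WISE ROUTE CLOSED INTO THE HYBRID SHAPE.**  INPUTS BY NAME (none printed as a two-run statement): the
binders of `T4TermwiseBudget.goodClause_summable_of_nodes` verbatim — the sibling nodes' typed outputs (NE9 + fading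
memory, Lipschitz-in-the-background with polynomial growth, NE5, NE3 as `LocalRate` + `GaugeDominated`, node U2's injected
coupling rate on the printed box, both runs' couplings in the window), the term format (F), one-run sizes (S),
multiplicity (M), the other kinds (O) with `Summable rO` — PLUS NE7's OTHER HALF, the weight budget
`T4WeightBudget.RelWeightBound l₀ T A B Bad Wb` (binder (W): sibling seats' output, NOT this route's, NOT PRINTED) and
non-negativity of every term (L1-pos).  OUTPUT: the tower's `K`-uniform rate constant `Cr ≥ 0` such that, GRANTED hazard
H-U5b-1 on the centres chosen with that `Cr` (binder (D): deviations `s`, `Summable s`), the datum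
`T4MatchingAssembly.HybridNE7` holds with ZERO shells, weight slot `Wb` and term-wise remainder
`δ K = max(Cw,1)·(E + Cr)·Σ_{j+n=K} min(aⁿ, θ′^jΛⁿ) + rO K + s K` (`hybridNE7_noShell`). [folklore] -/
theorem hybridNE7_of_nodes
    (h9 : NE9 EA W κ Λm) (hΛm : FadingMemory C₉ ω Λm) (hω : 0 ≤ ω)
    (hUL : LipBackground EA W κ CU) (hG : PolyLipGrowth CU g P q) (hP : 0 ≤ P)
    (h5 : NE5 EA EB W κ θ₅ C₅) (hθ₅ : 0 ≤ θ₅) (hC₅ : 0 ≤ C₅)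
    (hloc : LocalRate R C₃ θ₃) (hC₃ : 0 ≤ C₃) (hθ₃ : 0 ≤ θ₃) (hθ₃1 : θ₃ < 1) (hgd : GaugeDominated R uA uB)
    (hinj : InjectedRate Cd 0 θc (fun K j => T4CouplingMatching.disc (g K) (g (K + 1)) j)) (hCd : 0 ≤ Cd)
    (hθc : 0 ≤ θc) (hbox : ∀ K i, i ≤ K → 0 < g K i ∧ g K i ≤ γ)
    (hgA : ∀ K, g K ∈ W) (hgB : ∀ K, (fun i => g (K + 1) (i + 1)) ∈ W)
    (hθ' : max ω θc < θ') (hθ₅' : θ₅ ≤ θ') (hθ₃' : θ₃ ≤ θ')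
    (hfmtA : ∀ K t τ, A K t τ = ∫ v, (∏ X ∈ fac K t τ,
      Real.exp (EA (g K) (uA K v) X - EA (g K) oneA X)) * oA K t τ v ∂(μ K t τ))
    (hfmtB : ∀ K t τ, B K t τ = ∫ v, (∏ X ∈ fac K t τ,
      Real.exp (EB (fun i => g (K + 1) (i + 1)) (uB K v) X - EB (fun i => g (K + 1) (i + 1)) oneB X)) *
        oB K t τ v ∂(μ K t τ))
    (hint : ∀ K t, |t| ≤ l₀ → ∀ τ ∈ T K \ Bad K t,
      Integrable (fun v => (∏ X ∈ fac K t τ, Real.exp (EA (g K) (uA K v) X - EA (g K) oneA X)) *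
        oA K t τ v) (μ K t τ) ∧
      Integrable (fun v => (∏ X ∈ fac K t τ,
        Real.exp (EB (fun i => g (K + 1) (i + 1)) (uB K v) X - EB (fun i => g (K + 1) (i + 1)) oneB X)) *
        oB K t τ v) (μ K t τ))
    (hsc : ∀ K t, |t| ≤ l₀ → ∀ τ ∈ T K \ Bad K t, ∀ X ∈ fac K t τ, C.scale X ≤ K)
    (hposO : ∀ K t, |t| ≤ l₀ → ∀ τ ∈ T K \ Bad K t, ∀ v ∈ R.dom, 0 < oA K t τ v ∧ 0 < oB K t τ v)
    (hoff : ∀ K t, |t| ≤ l₀ → ∀ τ ∈ T K \ Bad K t, ∀ v, v ∉ R.dom →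
      (∏ X ∈ fac K t τ, Real.exp (EA (g K) (uA K v) X - EA (g K) oneA X)) * oA K t τ v = 0 ∧
      (∏ X ∈ fac K t τ,
        Real.exp (EB (fun i => g (K + 1) (i + 1)) (uB K v) X - EB (fun i => g (K + 1) (i + 1)) oneB X)) *
        oB K t τ v = 0)
    (hS : ∀ K t, |t| ≤ l₀ → ∀ τ ∈ T K \ Bad K t, ∀ v ∈ R.dom, ∀ j ≤ K,
      |(∑ X ∈ fac K t τ with C.scale X = j,
          (Real.log (Real.exp (EB (fun i => g (K + 1) (i + 1)) (uB K v) X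
              - EB (fun i => g (K + 1) (i + 1)) oneB X))
            - Real.log (Real.exp (EA (g K) (uA K v) X - EA (g K) oneA X)))) - κ₁ K t τ j| ≤ S K t τ j)
    (hM : ∀ K t, |t| ≤ l₀ → ∀ τ ∈ T K \ Bad K t,
      Multiplicity (fac K t τ) C.scale (fun X => Real.exp (-(κ * C.d X))) Cw vol Λ K)
    (hO : ∀ K t, |t| ≤ l₀ → ∀ τ ∈ T K \ Bad K t, ∀ v ∈ R.dom,
      |Real.log (oB K t τ v) - Real.log (oA K t τ v) - cO K t τ| ≤ RO K t τ)
    (hvol : 0 ≤ vol) (hE : 0 ≤ E) (ha0 : 0 < a) (ha1 : a < 1) (hθ'1 : θ' < 1) (hθ'Λ : θ' ≤ Λ)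
    (hSle : ∀ K t, |t| ≤ l₀ → ∀ τ ∈ T K \ Bad K t, ∀ j ≤ K, S K t τ j ≤ vol * (E * a ^ (K - j)))
    (hRO : ∀ K t, |t| ≤ l₀ → ∀ τ ∈ T K \ Bad K t, RO K t τ ≤ vol * rO K) (hrO : Summable rO)
    (hW : T4WeightBudget.RelWeightBound l₀ T A B Bad Wb)
    (hA : ∀ K t, |t| ≤ l₀ → ∀ τ ∈ T K, 0 ≤ A K t τ) (hB : ∀ K t, |t| ≤ l₀ → ∀ τ ∈ T K, 0 ≤ B K t τ) :
    ∃ Cr : ℝ, 0 ≤ Cr ∧ ∀ c₀ s : ℕ → ℝ, Summable s →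
      (∀ K t, |t| ≤ l₀ → ∀ τ ∈ T K \ Bad K t,
        |((∑ j ∈ range (K + 1), sliceCentre (κ₁ K t τ)
            (fun j => ∑ X ∈ fac K t τ with C.scale X = j,
              (-(EB (fun i => g (K + 1) (i + 1)) oneB X - EA (g K) oneA X)))
            (S K t τ) (fun j => Cw * vol * (Cr * θ' ^ j * Λ ^ (K - j))) j) + cO K t τ) - c₀ K| ≤ vol * s K) →
      HybridNE7 l₀ vol T A B Bad Wb (fun _ _ _ => 0) (fun _ _ _ => 0) (fun _ => 0)
        (fun K => (max Cw 1 * ((E + Cr) * ∑ x ∈ antidiagonal K, min (a ^ x.2) (θ' ^ x.1 * Λ ^ x.2)) + rO K)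
          + s K) := by
  obtain ⟨Cr, hCr, h⟩ := goodClause_summable_of_nodes h9 hΛm hω hUL hG hP h5 hθ₅ hC₅ hloc hC₃ hθ₃ hθ₃1 hgd hinj
    hCd hθc hbox hgA hgB hθ' hθ₅' hθ₃' hfmtA hfmtB hint hsc hposO hoff hS hM hO hvol hE ha0 ha1 hθ'1 hθ'Λ hSle hRO
    hrO
  refine ⟨Cr, hCr, fun c₀ s hs hdev => ?_⟩
  obtain ⟨hgood, hsum⟩ := h c₀ s hs hdev
  exact hybridNE7_noShell hW hA hB hsum hgood

/-- **NE7 ITSELF (node U5's output `T4CauchySum.MatchingModConstants`) AND NODE U6, FROM THE NODES.**  With the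
dictionary `Z K t = Σ_τ A K t τ`, `Z (K+1) t = Σ_τ B K t τ` on `|t| ≤ l₀` (nodes E1/E2, binders) and positivity of the
total (L1-pos), `0 < vol`, `0 ≤ l₀`: the matching modulo `t`-independent constants with the HYBRID remainder
`hybridDelta vol δ Wb K = δ K + (−log(1 − Wb K))/vol`, its summability, the Cauchy property of every generating function on
`|t| ≤ l₀` and uniform convergence there (`T4GoodClassBudget.cauchy_of_goodClause`).  CONDITIONAL on every binder
named; NE7 is NOT PRINTED. [folklore] -/
theorem ne7_of_nodes {Z : ℕ → ℝ → ℝ}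
    (h9 : NE9 EA W κ Λm) (hΛm : FadingMemory C₉ ω Λm) (hω : 0 ≤ ω)
    (hUL : LipBackground EA W κ CU) (hG : PolyLipGrowth CU g P q) (hP : 0 ≤ P)
    (h5 : NE5 EA EB W κ θ₅ C₅) (hθ₅ : 0 ≤ θ₅) (hC₅ : 0 ≤ C₅)
    (hloc : LocalRate R C₃ θ₃) (hC₃ : 0 ≤ C₃) (hθ₃ : 0 ≤ θ₃) (hθ₃1 : θ₃ < 1) (hgd : GaugeDominated R uA uB)
    (hinj : InjectedRate Cd 0 θc (fun K j => T4CouplingMatching.disc (g K) (g (K + 1)) j)) (hCd : 0 ≤ Cd)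
    (hθc : 0 ≤ θc) (hbox : ∀ K i, i ≤ K → 0 < g K i ∧ g K i ≤ γ)
    (hgA : ∀ K, g K ∈ W) (hgB : ∀ K, (fun i => g (K + 1) (i + 1)) ∈ W)
    (hθ' : max ω θc < θ') (hθ₅' : θ₅ ≤ θ') (hθ₃' : θ₃ ≤ θ')
    (hfmtA : ∀ K t τ, A K t τ = ∫ v, (∏ X ∈ fac K t τ,
      Real.exp (EA (g K) (uA K v) X - EA (g K) oneA X)) * oA K t τ v ∂(μ K t τ))
    (hfmtB : ∀ K t τ, B K t τ = ∫ v, (∏ X ∈ fac K t τ,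
      Real.exp (EB (fun i => g (K + 1) (i + 1)) (uB K v) X - EB (fun i => g (K + 1) (i + 1)) oneB X)) *
        oB K t τ v ∂(μ K t τ))
    (hint : ∀ K t, |t| ≤ l₀ → ∀ τ ∈ T K \ Bad K t,
      Integrable (fun v => (∏ X ∈ fac K t τ, Real.exp (EA (g K) (uA K v) X - EA (g K) oneA X)) *
        oA K t τ v) (μ K t τ) ∧
      Integrable (fun v => (∏ X ∈ fac K t τ,
        Real.exp (EB (fun i => g (K + 1) (i + 1)) (uB K v) X - EB (fun i => g (K + 1) (i + 1)) oneB X)) *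
        oB K t τ v) (μ K t τ))
    (hsc : ∀ K t, |t| ≤ l₀ → ∀ τ ∈ T K \ Bad K t, ∀ X ∈ fac K t τ, C.scale X ≤ K)
    (hposO : ∀ K t, |t| ≤ l₀ → ∀ τ ∈ T K \ Bad K t, ∀ v ∈ R.dom, 0 < oA K t τ v ∧ 0 < oB K t τ v)
    (hoff : ∀ K t, |t| ≤ l₀ → ∀ τ ∈ T K \ Bad K t, ∀ v, v ∉ R.dom →
      (∏ X ∈ fac K t τ, Real.exp (EA (g K) (uA K v) X - EA (g K) oneA X)) * oA K t τ v = 0 ∧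
      (∏ X ∈ fac K t τ,
        Real.exp (EB (fun i => g (K + 1) (i + 1)) (uB K v) X - EB (fun i => g (K + 1) (i + 1)) oneB X)) *
        oB K t τ v = 0)
    (hS : ∀ K t, |t| ≤ l₀ → ∀ τ ∈ T K \ Bad K t, ∀ v ∈ R.dom, ∀ j ≤ K,
      |(∑ X ∈ fac K t τ with C.scale X = j,
          (Real.log (Real.exp (EB (fun i => g (K + 1) (i + 1)) (uB K v) X
              - EB (fun i => g (K + 1) (i + 1)) oneB X))
            - Real.log (Real.exp (EA (g K) (uA K v) X - EA (g K) oneA X)))) - κ₁ K t τ j| ≤ S K t τ j)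
    (hM : ∀ K t, |t| ≤ l₀ → ∀ τ ∈ T K \ Bad K t,
      Multiplicity (fac K t τ) C.scale (fun X => Real.exp (-(κ * C.d X))) Cw vol Λ K)
    (hO : ∀ K t, |t| ≤ l₀ → ∀ τ ∈ T K \ Bad K t, ∀ v ∈ R.dom,
      |Real.log (oB K t τ v) - Real.log (oA K t τ v) - cO K t τ| ≤ RO K t τ)
    (hvol : 0 < vol) (hl₀ : 0 ≤ l₀) (hE : 0 ≤ E) (ha0 : 0 < a) (ha1 : a < 1) (hθ'1 : θ' < 1) (hθ'Λ : θ' ≤ Λ)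
    (hSle : ∀ K t, |t| ≤ l₀ → ∀ τ ∈ T K \ Bad K t, ∀ j ≤ K, S K t τ j ≤ vol * (E * a ^ (K - j)))
    (hRO : ∀ K t, |t| ≤ l₀ → ∀ τ ∈ T K \ Bad K t, RO K t τ ≤ vol * rO K) (hrO : Summable rO)
    (hW : T4WeightBudget.RelWeightBound l₀ T A B Bad Wb)
    (hA : ∀ K t, |t| ≤ l₀ → ∀ τ ∈ T K, 0 ≤ A K t τ) (hB : ∀ K t, |t| ≤ l₀ → ∀ τ ∈ T K, 0 ≤ B K t τ)
    (hZA : ∀ K t, |t| ≤ l₀ → Z K t = ∑ τ ∈ T K, A K t τ)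
    (hZB : ∀ K t, |t| ≤ l₀ → Z (K + 1) t = ∑ τ ∈ T K, B K t τ)
    (hpos : ∀ K t, |t| ≤ l₀ → 0 < ∑ τ ∈ T K, A K t τ) :
    ∃ Cr : ℝ, 0 ≤ Cr ∧ ∀ c₀ s : ℕ → ℝ, Summable s →
      (∀ K t, |t| ≤ l₀ → ∀ τ ∈ T K \ Bad K t,
        |((∑ j ∈ range (K + 1), sliceCentre (κ₁ K t τ)
            (fun j => ∑ X ∈ fac K t τ with C.scale X = j,
              (-(EB (fun i => g (K + 1) (i + 1)) oneB X - EA (g K) oneA X)))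
            (S K t τ) (fun j => Cw * vol * (Cr * θ' ^ j * Λ ^ (K - j))) j) + cO K t τ) - c₀ K| ≤ vol * s K) →
      MatchingModConstants vol l₀
          (hybridDelta vol (fun K => (max Cw 1 * ((E + Cr) *
            ∑ x ∈ antidiagonal K, min (a ^ x.2) (θ' ^ x.1 * Λ ^ x.2)) + rO K) + s K) Wb) Z ∧
        Summable (hybridDelta vol (fun K => (max Cw 1 * ((E + Cr) *
            ∑ x ∈ antidiagonal K, min (a ^ x.2) (θ' ^ x.1 * Λ ^ x.2)) + rO K) + s K) Wb) ∧
        (∀ t : ℝ, |t| ≤ l₀ → CauchySeq fun K => genFun Z K t) ∧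
        TendstoUniformlyOn (fun K t => genFun Z K t) (genFunLim Z) atTop {t | |t| ≤ l₀} := by
  obtain ⟨Cr, hCr, h⟩ := goodClause_summable_of_nodes h9 hΛm hω hUL hG hP h5 hθ₅ hC₅ hloc hC₃ hθ₃ hθ₃1 hgd hinj
    hCd hθc hbox hgA hgB hθ' hθ₅' hθ₃' hfmtA hfmtB hint hsc hposO hoff hS hM hO hvol.le hE ha0 ha1 hθ'1 hθ'Λ hSle
    hRO hrO
  refine ⟨Cr, hCr, fun c₀ s hs hdev => ?_⟩
  obtain ⟨hgood, hsum⟩ := h c₀ s hs hdev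
  exact cauchy_of_goodClause hvol hl₀ hW hZA hZB hA hB hpos hsum hgood

end Spine

/-! ## §2 Per string of a scheme, and all strings: the node-U0 targets with ONE rate constant for every string -/

section Scheme

open Missing T4Continuum T4Assembly
open T4EtaRateMin (Readings LocalRate)
open T4RateLiaison (GaugeDominated)

variable {G : Type*} [GaugeGroup G] [MeasurableSpace G] [HaarData G] {O : Type*}

variable {C : Carriers} {ι X : Type} [MeasurableSpace ι] {R : Readings ι X} {W : Set (ℕ → ℝ)}
  {EA : Functional C C.BgA} {EB : Functional C C.BgB} {κ θ₅ C₅ C₉ ω θc Cd γ C₃ θ₃ P θ' : ℝ} {q : ℕ}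
  {Λm : ℕ → ℕ → ℝ} {CU : (ℕ → ℝ) → ℕ → ℝ} {g : ℕ → ℕ → ℝ} {uA : ℕ → ι → C.BgA} {uB : ℕ → ι → C.BgB}
  {oneA : C.BgA} {oneB : C.BgB} {Cw E a Λ : ℝ}

/-- **PER STRING**: the binders of `hybridNE7_of_nodes` for the two runs' term families of ONE string `os` of a scheme
`Sc`, read off after `K₀ + K` resp. `K₀ + K + 1` steps through the E1/E2 DICTIONARY
`schemeZ Sc os (K₀+K) t = Σ_τ A K t τ`, `schemeZ Sc os (K₀+K+1) t = Σ_τ B K t τ` on `|t| ≤ l₀` (binders), give — for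
the tower's `Cr` and granted H-U5b-1 with it — `T4MatchingAssembly.StringHybridNE7 Sc os l₀ vol K₀`, literally the
per-string hypothesis of `matchingModConstants_schemeZ` / `genFunCauchy_of_hybridNE7` / `hasContinuumLimit_of_hybridNE7`
(index type in `Type`; `T4MatchingClosure.stringHybridNE7_intro`). [folklore] -/
theorem stringHybridNE7_of_nodes {σ : Type} [DecidableEq σ] {l₀ vol : ℝ} {T : ℕ → Finset σ}
    {Bad : ℕ → ℝ → Finset σ} {A B : ℕ → ℝ → σ → ℝ} {μ : ℕ → ℝ → σ → Measure ι} {fac : ℕ → ℝ → σ → Finset C.Dom}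
    {oA oB : ℕ → ℝ → σ → ι → ℝ} {κ₁ S : ℕ → ℝ → σ → ℕ → ℝ} {cO RO : ℕ → ℝ → σ → ℝ} {rO Wb : ℕ → ℝ}
    (Sc : TorusScheme G O) (os : List O) (K₀ : ℕ)
    (h9 : NE9 EA W κ Λm) (hΛm : FadingMemory C₉ ω Λm) (hω : 0 ≤ ω)
    (hUL : LipBackground EA W κ CU) (hG : PolyLipGrowth CU g P q) (hP : 0 ≤ P)
    (h5 : NE5 EA EB W κ θ₅ C₅) (hθ₅ : 0 ≤ θ₅) (hC₅ : 0 ≤ C₅)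
    (hloc : LocalRate R C₃ θ₃) (hC₃ : 0 ≤ C₃) (hθ₃ : 0 ≤ θ₃) (hθ₃1 : θ₃ < 1) (hgd : GaugeDominated R uA uB)
    (hinj : InjectedRate Cd 0 θc (fun K j => T4CouplingMatching.disc (g K) (g (K + 1)) j)) (hCd : 0 ≤ Cd)
    (hθc : 0 ≤ θc) (hbox : ∀ K i, i ≤ K → 0 < g K i ∧ g K i ≤ γ)
    (hgA : ∀ K, g K ∈ W) (hgB : ∀ K, (fun i => g (K + 1) (i + 1)) ∈ W)
    (hθ' : max ω θc < θ') (hθ₅' : θ₅ ≤ θ') (hθ₃' : θ₃ ≤ θ')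
    (hfmtA : ∀ K t τ, A K t τ = ∫ v, (∏ X ∈ fac K t τ,
      Real.exp (EA (g K) (uA K v) X - EA (g K) oneA X)) * oA K t τ v ∂(μ K t τ))
    (hfmtB : ∀ K t τ, B K t τ = ∫ v, (∏ X ∈ fac K t τ,
      Real.exp (EB (fun i => g (K + 1) (i + 1)) (uB K v) X - EB (fun i => g (K + 1) (i + 1)) oneB X)) *
        oB K t τ v ∂(μ K t τ))
    (hint : ∀ K t, |t| ≤ l₀ → ∀ τ ∈ T K \ Bad K t,
      Integrable (fun v => (∏ X ∈ fac K t τ, Real.exp (EA (g K) (uA K v) X - EA (g K) oneA X)) *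
        oA K t τ v) (μ K t τ) ∧
      Integrable (fun v => (∏ X ∈ fac K t τ,
        Real.exp (EB (fun i => g (K + 1) (i + 1)) (uB K v) X - EB (fun i => g (K + 1) (i + 1)) oneB X)) *
        oB K t τ v) (μ K t τ))
    (hsc : ∀ K t, |t| ≤ l₀ → ∀ τ ∈ T K \ Bad K t, ∀ X ∈ fac K t τ, C.scale X ≤ K)
    (hposO : ∀ K t, |t| ≤ l₀ → ∀ τ ∈ T K \ Bad K t, ∀ v ∈ R.dom, 0 < oA K t τ v ∧ 0 < oB K t τ v)
    (hoff : ∀ K t, |t| ≤ l₀ → ∀ τ ∈ T K \ Bad K t, ∀ v, v ∉ R.dom →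
      (∏ X ∈ fac K t τ, Real.exp (EA (g K) (uA K v) X - EA (g K) oneA X)) * oA K t τ v = 0 ∧
      (∏ X ∈ fac K t τ,
        Real.exp (EB (fun i => g (K + 1) (i + 1)) (uB K v) X - EB (fun i => g (K + 1) (i + 1)) oneB X)) *
        oB K t τ v = 0)
    (hS : ∀ K t, |t| ≤ l₀ → ∀ τ ∈ T K \ Bad K t, ∀ v ∈ R.dom, ∀ j ≤ K,
      |(∑ X ∈ fac K t τ with C.scale X = j,
          (Real.log (Real.exp (EB (fun i => g (K + 1) (i + 1)) (uB K v) X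
              - EB (fun i => g (K + 1) (i + 1)) oneB X))
            - Real.log (Real.exp (EA (g K) (uA K v) X - EA (g K) oneA X)))) - κ₁ K t τ j| ≤ S K t τ j)
    (hM : ∀ K t, |t| ≤ l₀ → ∀ τ ∈ T K \ Bad K t,
      Multiplicity (fac K t τ) C.scale (fun X => Real.exp (-(κ * C.d X))) Cw vol Λ K)
    (hO : ∀ K t, |t| ≤ l₀ → ∀ τ ∈ T K \ Bad K t, ∀ v ∈ R.dom,
      |Real.log (oB K t τ v) - Real.log (oA K t τ v) - cO K t τ| ≤ RO K t τ)
    (hvol : 0 ≤ vol) (hE : 0 ≤ E) (ha0 : 0 < a) (ha1 : a < 1) (hθ'1 : θ' < 1) (hθ'Λ : θ' ≤ Λ)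
    (hSle : ∀ K t, |t| ≤ l₀ → ∀ τ ∈ T K \ Bad K t, ∀ j ≤ K, S K t τ j ≤ vol * (E * a ^ (K - j)))
    (hRO : ∀ K t, |t| ≤ l₀ → ∀ τ ∈ T K \ Bad K t, RO K t τ ≤ vol * rO K) (hrO : Summable rO)
    (hW : T4WeightBudget.RelWeightBound l₀ T A B Bad Wb)
    (hA : ∀ K t, |t| ≤ l₀ → ∀ τ ∈ T K, 0 ≤ A K t τ) (hB : ∀ K t, |t| ≤ l₀ → ∀ τ ∈ T K, 0 ≤ B K t τ)
    (hZA : ∀ K t, |t| ≤ l₀ → T4GenFunBounds.schemeZ Sc os (K₀ + K) t = ∑ τ ∈ T K, A K t τ)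
    (hZB : ∀ K t, |t| ≤ l₀ → T4GenFunBounds.schemeZ Sc os (K₀ + K + 1) t = ∑ τ ∈ T K, B K t τ) :
    ∃ Cr : ℝ, 0 ≤ Cr ∧ ∀ c₀ s : ℕ → ℝ, Summable s →
      (∀ K t, |t| ≤ l₀ → ∀ τ ∈ T K \ Bad K t,
        |((∑ j ∈ range (K + 1), sliceCentre (κ₁ K t τ)
            (fun j => ∑ X ∈ fac K t τ with C.scale X = j,
              (-(EB (fun i => g (K + 1) (i + 1)) oneB X - EA (g K) oneA X)))
            (S K t τ) (fun j => Cw * vol * (Cr * θ' ^ j * Λ ^ (K - j))) j) + cO K t τ) - c₀ K| ≤ vol * s K) →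
      StringHybridNE7 Sc os l₀ vol K₀ := by
  obtain ⟨Cr, hCr, h⟩ := hybridNE7_of_nodes h9 hΛm hω hUL hG hP h5 hθ₅ hC₅ hloc hC₃ hθ₃ hθ₃1 hgd hinj hCd hθc hbox
    hgA hgB hθ' hθ₅' hθ₃' hfmtA hfmtB hint hsc hposO hoff hS hM hO hvol hE ha0 ha1 hθ'1 hθ'Λ hSle hRO hrO hW hA hB
  refine ⟨Cr, hCr, fun c₀ s hs hdev => ?_⟩
  exact T4MatchingClosure.stringHybridNE7_intro Sc os K₀ (h c₀ s hs hdev) hZA hZB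

/-- **ALL STRINGS, END TO END — THE TERM-WISE ROUTE'S CAPSTONE (lineage t4-ne7-p1, gens 1–4).**  The tower data are
STRING-INDEPENDENT (the sibling nodes' typed outputs, NOT PRINTED as two-run statements); the term data are indexed by
the string `os` (index types `σ os`, families `T os`, `Bad os`, `A os`, `B os`, …, a volume factor `vol os > 0` and a head
length `K₀ os`), with the per-string binders (F) format, (S) sizes, (M) multiplicity, (O) other kinds + `Summable (rO os)`,
(W) the weight half `RelWeightBound`, L1-pos, and the E1/E2 dictionary to `schemeZ Sc os (K₀ os + K)`.  CONCLUSION: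
there is ONE rate constant `Cr ≥ 0` — the tower's, the same for every string — such that, GRANTED hazard H-U5b-1 on every
string with that `Cr` (binder (D): per string some `t`-independent class constants `c₀` and summable deviations `s`),
the node-U0 targets hold for the scheme: the continuum limit of every joint expectation of the gauge-invariant
observables EXISTS along the full sequence of spacings, limit points are UNIQUE, and subsequential limits AGREE
(`T4MatchingAssembly.hasContinuumLimit_of_hybridNE7`, `0 < l₀`, scheme regularity `0 ≤ β_K`, measurable observables
bounded by `1`).  HONEST FRAMING: pure YM₄ on a FIXED FINITE torus, rung (B)+1 of the cell's ladder, CONDITIONAL on every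
binder named here — in particular NE7 (both halves) is NOT PRINTED and the upstream conditionals (BetaPertH behind node
U2's asymptotic-freedom input, (B), (B^μ)) sit inside the producers of `hinj` / the weight half exactly as those modules
name them; nothing here is infinite volume, a mass gap, or the Clay problem. [folklore] -/
theorem hasContinuumLimit_of_nodes [RegularGaugeGroup G] {σ : List O → Type} [∀ os, DecidableEq (σ os)] {l₀ : ℝ}
    {vol : List O → ℝ} {K₀ : List O → ℕ} {T : (os : List O) → ℕ → Finset (σ os)}
    {Bad : (os : List O) → ℕ → ℝ → Finset (σ os)} {A B : (os : List O) → ℕ → ℝ → σ os → ℝ}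
    {μ : (os : List O) → ℕ → ℝ → σ os → Measure ι} {fac : (os : List O) → ℕ → ℝ → σ os → Finset C.Dom}
    {oA oB : (os : List O) → ℕ → ℝ → σ os → ι → ℝ} {κ₁ S : (os : List O) → ℕ → ℝ → σ os → ℕ → ℝ}
    {cO RO : (os : List O) → ℕ → ℝ → σ os → ℝ} {rO Wb : List O → ℕ → ℝ}
    (Sc : TorusScheme G O) (hβ : ∀ K, 0 ≤ Sc.β K) (hm : ∀ K o, Measurable (Sc.obs K o))
    (h1 : ∀ K o U, |Sc.obs K o U| ≤ 1) (hl₀ : 0 < l₀)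
    (h9 : NE9 EA W κ Λm) (hΛm : FadingMemory C₉ ω Λm) (hω : 0 ≤ ω)
    (hUL : LipBackground EA W κ CU) (hG : PolyLipGrowth CU g P q) (hP : 0 ≤ P)
    (h5 : NE5 EA EB W κ θ₅ C₅) (hθ₅ : 0 ≤ θ₅) (hC₅ : 0 ≤ C₅)
    (hloc : LocalRate R C₃ θ₃) (hC₃ : 0 ≤ C₃) (hθ₃ : 0 ≤ θ₃) (hθ₃1 : θ₃ < 1) (hgd : GaugeDominated R uA uB)
    (hinj : InjectedRate Cd 0 θc (fun K j => T4CouplingMatching.disc (g K) (g (K + 1)) j)) (hCd : 0 ≤ Cd)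
    (hθc : 0 ≤ θc) (hbox : ∀ K i, i ≤ K → 0 < g K i ∧ g K i ≤ γ)
    (hgA : ∀ K, g K ∈ W) (hgB : ∀ K, (fun i => g (K + 1) (i + 1)) ∈ W)
    (hθ' : max ω θc < θ') (hθ₅' : θ₅ ≤ θ') (hθ₃' : θ₃ ≤ θ')
    (hE : 0 ≤ E) (ha0 : 0 < a) (ha1 : a < 1) (hθ'1 : θ' < 1) (hθ'Λ : θ' ≤ Λ)
    (hvol : ∀ os, 0 < vol os)
    (hfmtA : ∀ os K t τ, A os K t τ = ∫ v, (∏ X ∈ fac os K t τ,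
      Real.exp (EA (g K) (uA K v) X - EA (g K) oneA X)) * oA os K t τ v ∂(μ os K t τ))
    (hfmtB : ∀ os K t τ, B os K t τ = ∫ v, (∏ X ∈ fac os K t τ,
      Real.exp (EB (fun i => g (K + 1) (i + 1)) (uB K v) X - EB (fun i => g (K + 1) (i + 1)) oneB X)) *
        oB os K t τ v ∂(μ os K t τ))
    (hint : ∀ os K t, |t| ≤ l₀ → ∀ τ ∈ T os K \ Bad os K t,
      Integrable (fun v => (∏ X ∈ fac os K t τ, Real.exp (EA (g K) (uA K v) X - EA (g K) oneA X)) *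
        oA os K t τ v) (μ os K t τ) ∧
      Integrable (fun v => (∏ X ∈ fac os K t τ,
        Real.exp (EB (fun i => g (K + 1) (i + 1)) (uB K v) X - EB (fun i => g (K + 1) (i + 1)) oneB X)) *
        oB os K t τ v) (μ os K t τ))
    (hsc : ∀ os K t, |t| ≤ l₀ → ∀ τ ∈ T os K \ Bad os K t, ∀ X ∈ fac os K t τ, C.scale X ≤ K)
    (hposO : ∀ os K t, |t| ≤ l₀ → ∀ τ ∈ T os K \ Bad os K t, ∀ v ∈ R.dom, 0 < oA os K t τ v ∧ 0 < oB os K t τ v)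
    (hoff : ∀ os K t, |t| ≤ l₀ → ∀ τ ∈ T os K \ Bad os K t, ∀ v, v ∉ R.dom →
      (∏ X ∈ fac os K t τ, Real.exp (EA (g K) (uA K v) X - EA (g K) oneA X)) * oA os K t τ v = 0 ∧
      (∏ X ∈ fac os K t τ,
        Real.exp (EB (fun i => g (K + 1) (i + 1)) (uB K v) X - EB (fun i => g (K + 1) (i + 1)) oneB X)) *
        oB os K t τ v = 0)
    (hS : ∀ os K t, |t| ≤ l₀ → ∀ τ ∈ T os K \ Bad os K t, ∀ v ∈ R.dom, ∀ j ≤ K,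
      |(∑ X ∈ fac os K t τ with C.scale X = j,
          (Real.log (Real.exp (EB (fun i => g (K + 1) (i + 1)) (uB K v) X
              - EB (fun i => g (K + 1) (i + 1)) oneB X))
            - Real.log (Real.exp (EA (g K) (uA K v) X - EA (g K) oneA X)))) - κ₁ os K t τ j| ≤ S os K t τ j)
    (hM : ∀ os K t, |t| ≤ l₀ → ∀ τ ∈ T os K \ Bad os K t,
      Multiplicity (fac os K t τ) C.scale (fun X => Real.exp (-(κ * C.d X))) Cw (vol os) Λ K)
    (hO : ∀ os K t, |t| ≤ l₀ → ∀ τ ∈ T os K \ Bad os K t, ∀ v ∈ R.dom,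
      |Real.log (oB os K t τ v) - Real.log (oA os K t τ v) - cO os K t τ| ≤ RO os K t τ)
    (hSle : ∀ os K t, |t| ≤ l₀ → ∀ τ ∈ T os K \ Bad os K t, ∀ j ≤ K,
      S os K t τ j ≤ vol os * (E * a ^ (K - j)))
    (hRO : ∀ os K t, |t| ≤ l₀ → ∀ τ ∈ T os K \ Bad os K t, RO os K t τ ≤ vol os * rO os K)
    (hrO : ∀ os, Summable (rO os))
    (hW : ∀ os, T4WeightBudget.RelWeightBound l₀ (T os) (A os) (B os) (Bad os) (Wb os))
    (hA : ∀ os K t, |t| ≤ l₀ → ∀ τ ∈ T os K, 0 ≤ A os K t τ)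
    (hB : ∀ os K t, |t| ≤ l₀ → ∀ τ ∈ T os K, 0 ≤ B os K t τ)
    (hZA : ∀ os K t, |t| ≤ l₀ → T4GenFunBounds.schemeZ Sc os (K₀ os + K) t = ∑ τ ∈ T os K, A os K t τ)
    (hZB : ∀ os K t, |t| ≤ l₀ → T4GenFunBounds.schemeZ Sc os (K₀ os + K + 1) t = ∑ τ ∈ T os K, B os K t τ) :
    ∃ Cr : ℝ, 0 ≤ Cr ∧
      ((∀ os, ∃ c₀ s : ℕ → ℝ, Summable s ∧
        ∀ K t, |t| ≤ l₀ → ∀ τ ∈ T os K \ Bad os K t,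
          |((∑ j ∈ range (K + 1), sliceCentre (κ₁ os K t τ)
              (fun j => ∑ X ∈ fac os K t τ with C.scale X = j,
                (-(EB (fun i => g (K + 1) (i + 1)) oneB X - EA (g K) oneA X)))
              (S os K t τ) (fun j => Cw * vol os * (Cr * θ' ^ j * Λ ^ (K - j))) j) + cO os K t τ) - c₀ K|
            ≤ vol os * s K) →
      HasContinuumLimit Sc ∧ HasUniqueLimitPoints Sc ∧ LimitPointsAgree Sc) := by
  -- the tower's rate, string-independent (gen 2, `T4TowerRateDischarge.uRateUpTo_of_nodes`)
  obtain ⟨a₀, ha₀, hUK⟩ := uRateUpTo_of_nodes h9 hΛm hω hUL hG hP h5 hθ₅ hC₅ hloc hC₃ hθ₃ hθ₃1 hgd hinj hCd hθc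
    hbox hgA hgB hθ' hθ₅' hθ₃'
  have hθ'0 : 0 < θ' := lt_of_le_of_lt (hθc.trans (le_max_right ω θc)) hθ'
  have hΛ : 0 ≤ Λ := hθ'0.le.trans hθ'Λ
  have hC₉ : 0 ≤ C₉ := fadingMemory_const_nonneg hΛm
  have hD : 0 ≤ γ ^ 3 * Cd := mul_nonneg (pow_nonneg (box_nonneg hbox) 3) hCd
  set Cr : ℝ := a₀ + C₉ * (γ ^ 3 * Cd) * (θ' / (θ' - max ω θc)) + C₅ with hCr_def
  have hCr : 0 ≤ Cr :=
    add_nonneg (add_nonneg ha₀ (mul_nonneg (mul_nonneg hC₉ hD) (div_nonneg hθ'0.le (sub_pos.mpr hθ').le))) hC₅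
  have hsumE : Summable (fun K : ℕ => (E + Cr) * ∑ x ∈ antidiagonal K, min (a ^ x.2) (θ' ^ x.1 * Λ ^ x.2)) := by
    refine (summable_eBranch_poly (p := 0) hE hCr ha0 ha1 hθ'0 hθ'1 hθ'Λ).congr fun K => ?_
    rw [pow_zero, mul_one]
  refine ⟨Cr, hCr, fun hdev => hasContinuumLimit_of_hybridNE7 Sc hβ hm h1 hl₀ fun os => ?_⟩
  obtain ⟨c₀, s, hs, hd⟩ := hdev os
  -- gen 3: the per-term budget fed by the tower rate, then the good clause with `Summable δ`
  have hTB := termBudget_of_towerRate (gA := g) (gB := fun K i => g (K + 1) (i + 1)) (uA := fun K _ _ => uA K)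
    (uB := fun K _ _ => uB K) (Adm := fun _ _ _ => R.dom) (Cr := fun _ => Cr)
    (hfmtA os) (hfmtB os) (hint os) (hsc os) (hposO os) (hoff os) (hS os) (fun K t _ τ _ => hUK K) (hM os) (hO os)
    (hvol os).le hE ha0.le hθ'0.le hΛ (fun _ => hCr) (hSle os) (hRO os) hd
  obtain ⟨hgood, hsum⟩ := goodClause_summable_of_ledgerBudget (Cr := fun _ => Cr) hTB hsumE (hrO os) hs
  exact ⟨vol os, K₀ os, hvol os,
    T4MatchingClosure.stringHybridNE7_intro Sc os (K₀ os) (hybridNE7_noShell (hW os) (hA os) (hB os) hsum hgood)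
      (hZA os) (hZB os)⟩

end Scheme

/-! ## §3 The quantitative tail of the route: the E-branch is (K+1)q^K; explicit tails of `|genFun Z K t − genFunLim Z t|` -/

section Rate

/-- THE E-BRANCH OF `δ_K` IS GEOMETRIC UP TO A LINEAR FACTOR: for `0 < a < 1`, `0 < θ′ ≤ Λ` and `0 ≤ E + Cr`,
`max(Cw,1)·(E + Cr)·Σ_{j+n=K} min(aⁿ, θ′^jΛⁿ) ≤ max(Cw,1)·(E + Cr)·(K+1)·q^K` with the CROSSOVER RATE
`q = θ′^{log(1/a)/(log(Λ/θ′)+log(1/a))}` (`T4Crossover.sum_min_pow_le_crossover`; `q < 1` for `θ′ < 1` by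
`T4Crossover.crossoverRate_lt_one`). [folklore] -/
theorem eBranch_le_crossover {Cw E Cr a θ Λ : ℝ} (hECr : 0 ≤ E + Cr) (ha0 : 0 < a) (ha1 : a < 1) (hθ : 0 < θ)
    (hθΛ : θ ≤ Λ) (K : ℕ) :
    max Cw 1 * ((E + Cr) * ∑ x ∈ antidiagonal K, min (a ^ x.2) (θ ^ x.1 * Λ ^ x.2))
      ≤ max Cw 1 * (E + Cr) *
        (((K : ℝ) + 1) * (θ ^ (Real.log (1 / a) / (Real.log (Λ / θ) + Real.log (1 / a)))) ^ K) := by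
  rw [mul_assoc]
  exact mul_le_mul_of_nonneg_left (mul_le_mul_of_nonneg_left (sum_min_pow_le_crossover ha0 ha1 hθ hθΛ K) hECr)
    (zero_le_one.trans (le_max_right _ _))

/-- … hence the route's term-wise remainder is majorised SUMMAND BY SUMMAND:
`δ_K ≤ max(Cw,1)(E + Cr)·(K+1)q^K + rO K + s K` — the E-branch geometric×linear, the other kinds' `rO` and the H-U5b-1
deviations `s` exactly as their producers deliver them (binders; along the tree's present producers only POLYNOMIALLY
summable: `T4Crossover.summable_sum_min_coupling`, `T4MatchingClosure.summable_polyRate_of_kappa`). [folklore] -/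
theorem delta_le_crossover {Cw E Cr a θ Λ : ℝ} {rO s : ℕ → ℝ} (hECr : 0 ≤ E + Cr) (ha0 : 0 < a) (ha1 : a < 1)
    (hθ : 0 < θ) (hθΛ : θ ≤ Λ) (K : ℕ) :
    (max Cw 1 * ((E + Cr) * ∑ x ∈ antidiagonal K, min (a ^ x.2) (θ ^ x.1 * Λ ^ x.2)) + rO K) + s K
      ≤ max Cw 1 * (E + Cr) *
          (((K : ℝ) + 1) * (θ ^ (Real.log (1 / a) / (Real.log (Λ / θ) + Real.log (1 / a)))) ^ K)
        + rO K + s K :=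
  add_le_add (add_le_add (eBranch_le_crossover hECr ha0 ha1 hθ hθΛ K) le_rfl) le_rfl

/-- Under `MatchingModConstants vol l₀ δ Z` with `0 < vol`, `0 ≤ l₀` every remainder is non-negative (`t = 0` is
admissible). [folklore] -/
theorem delta_nonneg_of_matching {vol l₀ : ℝ} {δ : ℕ → ℝ} {Z : ℕ → ℝ → ℝ} (h : MatchingModConstants vol l₀ δ Z)
    (hvol : 0 < vol) (hl₀ : 0 ≤ l₀) (K : ℕ) : 0 ≤ δ K := by
  obtain ⟨c, hc⟩ := h K
  have h0 : 0 ≤ vol * δ K := (abs_nonneg _).trans (hc 0 (by simpa using hl₀))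
  nlinarith

/-- **TAIL BY COMPARISON**: if the remainders of `MatchingModConstants vol l₀ δ Z` are majorised, `δ K ≤ d K`, by a
summable `d`, then `|genFun Z K t − genFunLim Z t| ≤ 2·vol·Σ_m d (K+m)` on `|t| ≤ l₀`
(`T4CauchySum.abs_genFun_sub_lim_le`). [folklore] -/
theorem abs_genFun_sub_lim_le_of_le {vol l₀ : ℝ} {δ d : ℕ → ℝ} {Z : ℕ → ℝ → ℝ} (h : MatchingModConstants vol l₀ δ Z)
    (hvol : 0 < vol) (hl₀ : 0 ≤ l₀) (hle : ∀ K, δ K ≤ d K) (hd : Summable d) {t : ℝ} (ht : |t| ≤ l₀) (K : ℕ) :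
    |genFun Z K t - genFunLim Z t| ≤ 2 * vol * ∑' m, d (K + m) := by
  have hδ0 := delta_nonneg_of_matching h hvol hl₀
  have hδ : Summable δ := Summable.of_nonneg_of_le hδ0 hle hd
  have hdK : Summable (fun m => d (K + m)) := hd.comp_injective (add_right_injective K)
  have hδK : Summable (fun m => δ (K + m)) := hδ.comp_injective (add_right_injective K)
  refine (abs_genFun_sub_lim_le h hl₀ hδ ht K).trans ?_
  calc ∑' m, 2 * (vol * δ (K + m)) = 2 * vol * ∑' m, δ (K + m) := by
        rw [← tsum_mul_left]; exact tsum_congr fun m => by ring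
    _ ≤ 2 * vol * ∑' m, d (K + m) :=
        mul_le_mul_of_nonneg_left (Summable.tsum_le_tsum (fun m => hle (K + m)) hδK hdK) (by positivity)

/-- **GEOMETRIC TAIL**: `δ K ≤ D·ρ^K` (`0 ≤ ρ < 1`) ⇒ `|genFun Z K t − genFunLim Z t| ≤ 2·vol·D·ρ^K/(1 − ρ)`.
[folklore] -/
theorem abs_genFun_sub_lim_le_of_geometric {vol l₀ D ρ : ℝ} {δ : ℕ → ℝ} {Z : ℕ → ℝ → ℝ}
    (h : MatchingModConstants vol l₀ δ Z) (hvol : 0 < vol) (hl₀ : 0 ≤ l₀) (hρ0 : 0 ≤ ρ) (hρ1 : ρ < 1)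
    (hle : ∀ K, δ K ≤ D * ρ ^ K) {t : ℝ} (ht : |t| ≤ l₀) (K : ℕ) :
    |genFun Z K t - genFunLim Z t| ≤ 2 * vol * (D * ρ ^ K / (1 - ρ)) := by
  have hd : Summable (fun K => D * ρ ^ K) := (summable_geometric_of_lt_one hρ0 hρ1).mul_left D
  refine (abs_genFun_sub_lim_le_of_le h hvol hl₀ hle hd ht K).trans (le_of_eq ?_)
  congr 1
  have e : (fun m => D * ρ ^ (K + m)) = fun m => D * ρ ^ K * ρ ^ m := by
    funext m; rw [pow_add, mul_assoc]
  rw [e, tsum_mul_left, tsum_geometric_of_lt_one hρ0 hρ1, div_eq_mul_inv]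

/-- **(K+1)q^K TAIL** (the E-branch shape of `eBranch_le_crossover`): `δ K ≤ D·(K+1)·q^K` (`0 ≤ q < 1`) ⇒
`|genFun Z K t − genFunLim Z t| ≤ 2·vol·D·q^K·((K+1)/(1 − q) + q/(1 − q)²)` — from `Σ_m q^m = 1/(1−q)` and
`Σ_m m q^m = q/(1−q)²`. [folklore] -/
theorem abs_genFun_sub_lim_le_of_succ_mul_geometric {vol l₀ D q : ℝ} {δ : ℕ → ℝ} {Z : ℕ → ℝ → ℝ}
    (h : MatchingModConstants vol l₀ δ Z) (hvol : 0 < vol) (hl₀ : 0 ≤ l₀) (hq0 : 0 ≤ q) (hq1 : q < 1)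
    (hle : ∀ K, δ K ≤ D * (((K : ℝ) + 1) * q ^ K)) {t : ℝ} (ht : |t| ≤ l₀) (K : ℕ) :
    |genFun Z K t - genFunLim Z t| ≤ 2 * vol * (D * q ^ K * (((K : ℝ) + 1) / (1 - q) + q / (1 - q) ^ 2)) := by
  have hnorm : ‖q‖ < 1 := by rwa [Real.norm_of_nonneg hq0]
  have hs1 : Summable (fun K : ℕ => ((K : ℝ) + 1) * q ^ K) := by
    have := T4CauchySum.summable_succ_pow_mul_geometric hq0 hq1 1
    simpa only [pow_one] using this
  have hd : Summable (fun K : ℕ => D * (((K : ℝ) + 1) * q ^ K)) := hs1.mul_left D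
  refine (abs_genFun_sub_lim_le_of_le h hvol hl₀ hle hd ht K).trans (le_of_eq ?_)
  congr 1
  have hg : HasSum (fun m : ℕ => q ^ m) (1 - q)⁻¹ := hasSum_geometric_of_lt_one hq0 hq1
  have hm : HasSum (fun m : ℕ => (m : ℝ) * q ^ m) (q / (1 - q) ^ 2) := hasSum_coe_mul_geometric_of_norm_lt_one hnorm
  have hsum : HasSum (fun m : ℕ => D * ((((K + m : ℕ) : ℝ) + 1) * q ^ (K + m)))
      (D * q ^ K * (((K : ℝ) + 1) / (1 - q) + q / (1 - q) ^ 2)) := by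
    have h2 := ((hg.mul_left ((K : ℝ) + 1)).add hm).mul_left (D * q ^ K)
    rw [div_eq_mul_inv ((K : ℝ) + 1)]
    refine h2.congr_fun fun m => ?_
    push_cast
    rw [pow_add]
    ring
  exact hsum.tsum_eq

/-- **THE HYBRID REMAINDER MAJORISED**: `δ K ≤ d K`, `0 ≤ Wb K ≤ w K ≤ 1/2`, `0 < vol` ⇒
`hybridDelta vol δ Wb K ≤ d K + 2·w K/vol` — so the tail lemmas above apply to NE7's full remainder with the majorant
`d + 2w/vol`, whichever of the term-wise half `d` and the weight half `w` decays slower setting the rate.  The elementary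
step `−log(1 − x) ≤ 2x` on `[0, 1/2]` is the local bound of `T4HybridMatching.summable_neg_log_one_sub` (landed as a
lemma elsewhere in the Literature tree, `DFI1995.neg_log_one_sub_le`; not imported, to keep this cone topic-local).
[folklore] -/
theorem hybridDelta_le_of_le {vol : ℝ} (hvol : 0 < vol) {δ Wb d w : ℕ → ℝ} (hδ : ∀ K, δ K ≤ d K)
    (hW0 : ∀ K, 0 ≤ Wb K) (hW : ∀ K, Wb K ≤ w K) (hw : ∀ K, w K ≤ 1 / 2) (K : ℕ) :
    hybridDelta vol δ Wb K ≤ d K + 2 * w K / vol := by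
  unfold hybridDelta
  have hx1 : Wb K ≤ 1 / 2 := (hW K).trans (hw K)
  have hpos : 0 < 1 - Wb K := by linarith
  have hlog := Real.one_sub_inv_le_log_of_pos hpos
  have hinv : (1 - Wb K)⁻¹ ≤ 1 + 2 * Wb K := by
    rw [inv_eq_one_div, div_le_iff₀ hpos]
    nlinarith [hW0 K]
  have h1 : -Real.log (1 - Wb K) ≤ 2 * w K := by linarith [hW K]
  exact add_le_add (hδ K) (div_le_div_of_nonneg_right h1 hvol.le)

end Rate

end Literature.MathematicalPhysics.QuantumFieldTheory.Balaban1983to89.T4TermwiseClosure
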